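import Literature.Combinatorics.Optimization.QuantumBehaviorsCpsdFormulation
import Literature.MathematicalPhysics.QuantumLattice.TracePowerInequalities
import Literature.LinearAlgebra.Matrix.PosSemidefTrace
import HarnessLib

/-!
# Fidelity lower bounds on the psd-rank (Lee–Wei–de Wolf, `B₃`) and on `𝒟(p)` / the cpsd-rank
# over `𝒜(p)` (Sikora–Varvitsiotis–Wei)

Sources (held texts, `pNN` = chunk of the arXiv corpus text).
* T. Lee, Z. Wei, R. de Wolf, *Some upper and lower bounds on PSD-rank*, Math. Program. 162 (2017)
  495–521 = arXiv:1407.4308 [LeeWeiDeWolf2017] (`paper:arxiv-1407.4308`): §2 p05–p06 (Definition 1,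
  the rank bound (1) `rank(M) ≥ (‖M‖_tr/‖M‖_F)²`, "real PSD-rank", Facts 8–9 on the fidelity
  `F(ρ,σ) = ‖√σ√ρ‖_tr`), §4.1–4.2 p09 (Lemma 17, Definition 18, **Theorem 19** `rank_psd(P) ≥ B₃(P)`,
  Definition 20, **Corollary 21** `rank_psd(P) ≥ B₃'(P)`), §4.3–4.4 p10 (Theorems 24, 29).
* J. Sikora, A. Varvitsiotis, Z. Wei, *Minimum dimension of a Hilbert space needed to generate a
  quantum correlation*, Phys. Rev. Lett. 117 (2016) 060401 = arXiv:1507.00213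
  [SikoraVarvitsiotisWei2016] (`paper:arxiv-1507.00213`; equation numbers below are those of the
  arXiv text): p03–p04 "Deriving our lower bound" (steps (4)–(8), the bounds (9) `f₁`, (10) `f₂` and
  the **Theorem** `𝒟(p) ≥ ⌈max{f₁(p), f₂(p)}⌉`), p05 applications ((13) the generalised PR box;
  "Relation to Positive Semidefinite Rank").
The Letter's `𝒟(p)` (p02) is PSVW's `𝒟(p)` = `quantumDim` and its factor form (4)–(5) ([VS15]) is the
tree's dimension-exact dictionary `exists_cpsd_of_hasQuantumRep` / `hasQuantumRep_iff`
(`QuantumBehaviorsCpsdFormulation.lean`); by PSVW Theorem 2 a lower bound on `𝒟(p)` is a lower bound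
on the cpsd-rank of every `R ∈ CS_+ ∩ 𝒜(p)`. The special case `|X| = |Y| = 1` of the SVW bound is
the LWdW bound `B₃` on the psd-rank (p05 of the Letter), so both are kept in one file.

Contents (everything PROVED; the two printed theorems are also recorded as named `Prop`s with
`_holds` discharges — `LeeWeiDeWolf2017_thm19`, `SikoraVarvitsiotisWei2016_thm`; net fact debt 0).
* `FidelityBound.*` toolkit: the measurement inequality
  `Tr(QρQσ) ≤ (Σ_a √Tr(E_aρ) √Tr(E_aσ))²`, `Q = Σ_a E_a` (`re_trace_le_sq_sum_sqrt`; for a POVM,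
  `Q = I`, this is "`Tr(σρ) ≤ F(σ,ρ)² ≤ F(p,q)²`", LWdW Facts 8–9 / SVW (5)–(6)) and the dimension
  bound `|Tr(QΛ)|² ≤ r · Tr(QΛQΛ)` for psd `r × r` matrices (`normSq_trace_mul_le_card_mul`, the rank
  bound (1) applied to `ρ = CΛCᴴ`, `Q = CᴴC`).
* `classicalFidelity u v = Σ_i √u_i √v_i` (fidelity of distributions, p05).
* **LWdW Theorem 19** for every complex Hermitian psd factorization of size `r` of a column-stochastic
  `P` and every probability vector `q`: `1 ≤ r · Σ_{s,t} q_s q_t F(P_s,P_t)²`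
  (`LeeWeiDeWolf2017_thm19_factors`, division form `_inv_le`, the tree's real `HasPsdFactorization`
  form `_real`), and **Corollary 21** (row rescaling + column renormalisation, `_cor21_factors`).
* **SVW Theorem**: with `S_B(p; y₁,y₂; ξ) = Σ_{b₁,b₂} F(p(·b₁|ξ(b₁,b₂)y₁), p(·b₂|ξ(b₁,b₂)y₂))²`
  (`svwSumB`, and `svwSumA` for the Alice side), `1 ≤ d · S_B` for Sikora–Varvitsiotis factors of
  size `d` (`one_le_mul_svwSumB_of_factors`), for `R ∈ CS_+ ∩ 𝒜(p)` of cpsd-rank `≤ d`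
  (`…_of_hasCpsdFactorization`), for a `d`-dimensional representation (`…_of_hasQuantumRep`) and for
  `𝒟(p)` (`one_le_quantumDim_mul_svwSumB/A`, the printed `min_x` form `one_le_quantumDim_mul_sum_iInf`,
  the ceiling form in `SikoraVarvitsiotisWei2016_thm`); "witnessing non-quantumness"
  (`not_mem_quantumBehaviors_of_svwSumB_eq_zero`) with the generalised PR box (13) as worked example
  (`prBox_not_mem_quantumBehaviors`); "relation to PSD-rank" (p05): a `d`-dimensional representation
  gives complex psd factors of size `d` / a real psd factorization of size `2d` of the correlation
  matrix `(p(ab|xy))_{(x,a),(y,b)}` (`exists_psdFactors_of_hasQuantumRep`,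
  `hasPsdFactorization_of_hasQuantumRep`).
* (appended) **LWdW Lemma 17** (the normal form `Σ_i E_i = I`, `Tr F_j = 1`) and **Theorems 24
  (`B₄ = Σ_i max_j P(i,j)`) and 29 (`B₅`)** for the tree's real factorizations, for EVERY factorization
  of size `r` (`LeeWeiDeWolf2017_lemma17_real`, `_thm24_real`, `_thm24_real_sup`, `_thm29_real`), via the
  congruence normalisation `exists_posSemidef_sum_eq_one_congr` of `PsdRankBasicProperties.lean`.

Proof route (a recorded deviation from both printed proofs, same statements). The printed proofs
normalise the factorization (LWdW Lemma 17: "`Σ_i E_i` is full-rank" by size-minimality, then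
`V C' V† = I`; SVW: "`Σ_a E_{xa}` has full rank" by minimality of `d`, then `U (Σ_a E_{xa}) U† = I_d`),
bound `rank ρ ≥ ‖ρ‖_tr²/‖ρ‖_F²`, and use the fidelity `F(ρ,σ) = ‖√ρ√σ‖_tr` with `Tr(ρσ) ≤ F(ρ,σ)²`
and monotonicity under measurements [NC00]. Here no normalisation, no minimality, no trace norm and
no square roots are needed: writing `Q = Σ E = CᴴC` and `ρ = CΛCᴴ` gives
`|Tr(QΛ)|² = |Tr ρ|² ≤ r‖ρ‖_F² = r Tr(QΛQΛ)` (Cauchy–Schwarz with `I_r`), and with `ρ = C_ρᴴC_ρ`,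
`σ = C_σᴴC_σ`, `M_a = C_ρ E_a C_σᴴ`: `Tr(QρQσ) = ‖Σ_a M_a‖_F² ≤ (Σ_a ‖M_a‖_F)²`,
`‖M_a‖_F² = Tr(E_aσE_aρ) ≤ Tr(E_aρ)Tr(E_aσ)`. For Theorem 19 take `Q = Σ_i E_i`, `Λ = Σ_j q_j F_j`
(`Tr(QΛ) = Σ_j q_j Σ_i P(i,j) = 1`); for SVW take `Q = Λ = K`, the common row sum of the
Sikora–Varvitsiotis factors (`Tr K² = 1`, `Tr K⁴ = Σ_{b₁,b₂} Tr(K Y_{y₁b₁} K Y_{y₂b₂})` and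
`K = Σ_a X_{xa}` for every `x`). In particular the bounds are proved for EVERY factorization of the
given size, which is what "`rank_psd(P) ≥ B₃(P)`" and "`𝒟(p) ≥ f₁(p)`" unpack to. The Hilbert–Schmidt
Cauchy–Schwarz inequality is the tree's
`Literature.MathematicalPhysics.QuantumLattice.norm_trace_mul_le_sqrt_mul_sqrt`, the purity bound
`Tr A² ≤ (Tr A)²` is `Literature.LinearAlgebra.Matrix.re_trace_mul_self_le_sq_of_posSemidef`; the
Frobenius triangle inequality is taken in `EuclideanSpace ℂ (n × n)` (no matrix-norm instance).

Typing conventions. "`min_x (…)²`" in (9)–(10) is typed by an arbitrary selection `ξ(b₁,b₂)` of a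
setting (the minimising selection gives the printed expression; `one_le_quantumDim_mul_sum_iInf` is the
literal `⨅ x` form), "`max_q`" / "`max_{y₁,y₂}`" by universally quantified `q`, `y₁, y₂`, and
"`rank ≥ 1/S`" multiplicatively as `1 ≤ rank · S` (so `S = 0`, i.e. `f = +∞`, is allowed and means "no
factorization of any size", cf. the PR box); the rounding `⌈·⌉` of the Theorem is `Nat.ceil`.
LWdW's `rank_psd` allows complex Hermitian psd factors (p05); the tree's `HasPsdFactorization`
(FGPRT/LRS, real symmetric factors) is their "real PSD-rank" `≥ rank_psd`, whence the `_real` corollary.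

NOT typed here: the complex-factor (`rank_psd`) forms of LWdW Lemma 17 and Theorems 24, 29 as
printed (the appended real forms cover the tree's `HasPsdFactorization`; the complex ones need the
complex analogue of the congruence normalisation), the rescaled `B₄'`, `B₅'` (Cor. 26, 31), §3 (real vs
complex psd-rank, non-multiplicativity), the examples of §§4–6; SVW: tightness on CHSH / Magic Square ((11)–(12), `f₁ = 2, 4`), the non-convexity
witness `(p₁+p₂+p₃)/3` for `D₂`, the Fortnow–Feige–Lovász pattern (14), multiplicativity of `f₁` under product
correlations (needs product-behaviour vocabulary), the I3322 remarks.
-/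

noncomputable section

open Matrix Finset
open scoped ComplexOrder MatrixOrder
open Literature.MathematicalPhysics.QuantumLattice (norm_trace_mul_le_sqrt_mul_sqrt
  trace_mul_conjTranspose_self_re trace_mul_conjTranspose_self_re_nonneg)
open Literature.LinearAlgebra.Matrix (re_trace_mul_self_le_sq_of_posSemidef
  re_trace_mul_nonneg_of_posSemidef)

namespace Literature.Combinatorics.Optimization

/-! ### Toolkit: two trace inequalities for psd matrices (sub-namespace `FidelityBound`) -/

namespace FidelityBound

variable {n : Type*} [Fintype n] [DecidableEq n]

/-- For psd `A, B`: `Re Tr(AB) ≤ Tr A · Tr B` (`|Tr(AB)| ≤ ‖A‖_F ‖B‖_F ≤ Tr A · Tr B`). [folklore] -/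
private theorem re_trace_mul_le_mul_trace {A B : Matrix n n ℂ} (hA : A.PosSemidef)
    (hB : B.PosSemidef) : (A * B).trace.re ≤ A.trace.re * B.trace.re := by
  have hcs := norm_trace_mul_le_sqrt_mul_sqrt A B
  rw [hA.1.eq, hB.1.eq] at hcs
  have hA0 : 0 ≤ A.trace.re := (Complex.nonneg_iff.1 hA.trace_nonneg).1
  have hB0 : 0 ≤ B.trace.re := (Complex.nonneg_iff.1 hB.trace_nonneg).1
  have h1 : √((A * A).trace.re) ≤ A.trace.re := by
    rw [← Real.sqrt_sq hA0]
    exact Real.sqrt_le_sqrt (re_trace_mul_self_le_sq_of_posSemidef hA)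
  have h2 : √((B * B).trace.re) ≤ B.trace.re := by
    rw [← Real.sqrt_sq hB0]
    exact Real.sqrt_le_sqrt (re_trace_mul_self_le_sq_of_posSemidef hB)
  calc (A * B).trace.re ≤ ‖(A * B).trace‖ := Complex.re_le_norm _
    _ ≤ √((A * A).trace.re) * √((B * B).trace.re) := hcs
    _ ≤ A.trace.re * B.trace.re := mul_le_mul h1 h2 (Real.sqrt_nonneg _) hA0

/-- For psd `E, ρ, σ`: `Re Tr(EρEσ) ≤ Tr(Eρ) · Tr(Eσ)` (write `E = CᴴC`; then
`Tr(EρEσ) = Tr((CρCᴴ)(CσCᴴ)) ≤ Tr(CρCᴴ) Tr(CσCᴴ)`). [folklore] -/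
private theorem re_trace_mul_mul_mul_le {E ρ σ : Matrix n n ℂ} (hE : E.PosSemidef) (hρ : ρ.PosSemidef)
    (hσ : σ.PosSemidef) :
    (E * ρ * (E * σ)).trace.re ≤ (E * ρ).trace.re * (E * σ).trace.re := by
  obtain ⟨C, hC⟩ := CStarAlgebra.nonneg_iff_eq_star_mul_self.mp hE.nonneg
  rw [star_eq_conjTranspose] at hC
  have hA : (C * ρ * Cᴴ).PosSemidef := hρ.mul_mul_conjTranspose_same C
  have hB : (C * σ * Cᴴ).PosSemidef := hσ.mul_mul_conjTranspose_same C
  have e1 : (E * ρ * (E * σ)).trace = (C * ρ * Cᴴ * (C * σ * Cᴴ)).trace := by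
    rw [hC]
    simp only [Matrix.mul_assoc]
    rw [trace_mul_comm]
    simp only [Matrix.mul_assoc]
  have eA : (C * ρ * Cᴴ).trace = (E * ρ).trace := by
    rw [trace_mul_cycle, hC, Matrix.mul_assoc]
  have eB : (C * σ * Cᴴ).trace = (E * σ).trace := by
    rw [trace_mul_cycle, hC, Matrix.mul_assoc]
  rw [e1, ← eA, ← eB]
  exact re_trace_mul_le_mul_trace hA hB

/-- **The dimension bound.** For psd `r × r` matrices `Q, Λ`: `|Tr(QΛ)|² ≤ r · Tr(QΛQΛ)` — the rank
bound `rank(ρ) ≥ (‖ρ‖_tr/‖ρ‖_F)²` of LWdW (1) for `ρ = CΛCᴴ`, `Q = CᴴC` (`Tr ρ = Tr(QΛ)`,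
`‖ρ‖_F² = Tr(QΛQΛ)`, `rank ρ ≤ r`), in the form "`rank_psd(P) ≥ ‖ρ‖_tr²/‖ρ‖_F²`" used in the proof of
Theorem 19 and as "`Tr(ρ_y²) ≥ 1/d`" (SVW (8)).
[cite: LeeWeiDeWolf2017, eq. (1) (p05) and proof of Thm. 19 (p09); SikoraVarvitsiotisWei2016, p04] -/
theorem normSq_trace_mul_le_card_mul {Q Λ : Matrix n n ℂ} (hQ : Q.PosSemidef) (hΛ : Λ.PosSemidef) :
    ‖(Q * Λ).trace‖ ^ 2 ≤ Fintype.card n * (Q * Λ * (Q * Λ)).trace.re := by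
  obtain ⟨C, hC⟩ := CStarAlgebra.nonneg_iff_eq_star_mul_self.mp hQ.nonneg
  rw [star_eq_conjTranspose] at hC
  have hρ : (C * Λ * Cᴴ).PosSemidef := hΛ.mul_mul_conjTranspose_same C
  have e1 : (C * Λ * Cᴴ).trace = (Q * Λ).trace := by
    rw [trace_mul_cycle, hC, Matrix.mul_assoc]
  have e2 : (C * Λ * Cᴴ * (C * Λ * Cᴴ)).trace = (Q * Λ * (Q * Λ)).trace := by
    rw [hC]
    simp only [Matrix.mul_assoc]
    rw [trace_mul_comm C]
    simp only [Matrix.mul_assoc]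
    rw [trace_mul_comm Λ]
    simp only [Matrix.mul_assoc]
  set ρ := C * Λ * Cᴴ
  have hcs := norm_trace_mul_le_sqrt_mul_sqrt (1 : Matrix n n ℂ) ρ
  rw [Matrix.one_mul, conjTranspose_one, Matrix.mul_one, hρ.1.eq, trace_one] at hcs
  have hcard : ((Fintype.card n : ℂ)).re = Fintype.card n := by simp
  rw [hcard] at hcs
  rw [← e1, ← e2]
  have h0 : 0 ≤ (ρ * ρ).trace.re := by
    have := trace_mul_conjTranspose_self_re_nonneg ρ
    rwa [hρ.1.eq] at this
  calc ‖ρ.trace‖ ^ 2 ≤ (√(Fintype.card n : ℝ) * √((ρ * ρ).trace.re)) ^ 2 := by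
        gcongr
    _ = Fintype.card n * (ρ * ρ).trace.re := by
        rw [mul_pow, Real.sq_sqrt (Nat.cast_nonneg _), Real.sq_sqrt h0]

/-- Flattening a square matrix into a vector of `EuclideanSpace ℂ (n × n)` (to borrow the triangle
inequality of the Frobenius norm without a matrix-norm instance). [folklore] -/
private def toE (M : Matrix n n ℂ) : EuclideanSpace ℂ (n × n) := WithLp.toLp 2 fun ij => M ij.1 ij.2

omit [Fintype n] [DecidableEq n] in
/-- `toE` is additive. [folklore] -/
private theorem toE_add (M N : Matrix n n ℂ) : toE (M + N) = toE M + toE N := by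
  ext ij; simp [toE]

omit [Fintype n] [DecidableEq n] in
/-- `toE 0 = 0`. [folklore] -/
private theorem toE_zero : toE (0 : Matrix n n ℂ) = 0 := by
  ext ij; simp [toE]

omit [Fintype n] [DecidableEq n] in
/-- `toE` of a finite sum. [folklore] -/
private theorem toE_sum {ι : Type*} (s : Finset ι) (M : ι → Matrix n n ℂ) :
    toE (∑ a ∈ s, M a) = ∑ a ∈ s, toE (M a) := by
  induction s using Finset.cons_induction with
  | empty => simp [toE_zero]
  | cons a s ha ih => rw [Finset.sum_cons, Finset.sum_cons, toE_add, ih]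

omit [DecidableEq n] in
/-- `‖toE M‖² = Tr(M Mᴴ) = ‖M‖_F²`. [folklore] -/
private theorem norm_toE_sq (M : Matrix n n ℂ) : ‖toE M‖ ^ 2 = (M * Mᴴ).trace.re := by
  rw [EuclideanSpace.norm_eq, Real.sq_sqrt (Finset.sum_nonneg fun _ _ => by positivity),
    trace_mul_conjTranspose_self_re, Fintype.sum_prod_type]
  rfl

omit [DecidableEq n] in
/-- `‖toE M‖ = √Tr(M Mᴴ)`. [folklore] -/
private theorem norm_toE (M : Matrix n n ℂ) : ‖toE M‖ = √((M * Mᴴ).trace.re) := by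
  rw [← norm_toE_sq, Real.sqrt_sq (norm_nonneg _)]

/-- **The measurement (fidelity) inequality.** For psd `ρ, σ` and a finite psd family `E_a` with
`Q = Σ_a E_a`: `Re Tr(QρQσ) ≤ (Σ_a √Tr(E_aρ) · √Tr(E_aσ))²`. For a POVM (`Q = I`) this is
`Tr(ρσ) ≤ F(p,q)²` with `p_a = Tr(E_aρ)`, `q_a = Tr(E_aσ)` — LWdW Fact 8 (`Tr(σρ) ≤ F(σ,ρ)²`) combined
with Fact 9 (`F(σ,ρ) ≤ F(p,q)` for every POVM, [NC00]) = SVW (5)–(6); proved here directly with the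
Frobenius norm (`M_a = C_ρ E_a C_σᴴ`, `‖Σ M_a‖_F ≤ Σ ‖M_a‖_F`, `‖M_a‖_F² = Tr(E_aσE_aρ) ≤ Tr(E_aρ)Tr(E_aσ)`),
for an arbitrary psd `Q` (no POVM normalisation).
[cite: LeeWeiDeWolf2017, Facts 8–9 (p05–p06); SikoraVarvitsiotisWei2016, eqs. (5)–(6) (p04)] -/
theorem re_trace_le_sq_sum_sqrt {ι : Type*} [Fintype ι] (E : ι → Matrix n n ℂ)
    (hE : ∀ a, (E a).PosSemidef) {ρ σ : Matrix n n ℂ} (hρ : ρ.PosSemidef) (hσ : σ.PosSemidef) :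
    ((∑ a, E a) * ρ * ((∑ a, E a) * σ)).trace.re ≤
      (∑ a, √((E a * ρ).trace.re) * √((E a * σ).trace.re)) ^ 2 := by
  obtain ⟨Cρ, hCρ⟩ := CStarAlgebra.nonneg_iff_eq_star_mul_self.mp hρ.nonneg
  obtain ⟨Cσ, hCσ⟩ := CStarAlgebra.nonneg_iff_eq_star_mul_self.mp hσ.nonneg
  rw [star_eq_conjTranspose] at hCρ hCσ
  set Q := ∑ a, E a with hQdef
  have hQh : Q.IsHermitian := (posSemidef_sum Finset.univ fun a _ => hE a).1
  -- `M_a = C_ρ E_a C_σᴴ` and `M = Σ_a M_a = C_ρ Q C_σᴴ`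
  set Ma : ι → Matrix n n ℂ := fun a => Cρ * E a * Cσᴴ with hMadef
  have hM : ∑ a, Ma a = Cρ * Q * Cσᴴ := by
    rw [hMadef, hQdef, Finset.mul_sum, Finset.sum_mul]
  -- the left side is `‖M‖_F²`
  have hL : (Q * ρ * (Q * σ)).trace.re = ‖toE (∑ a, Ma a)‖ ^ 2 := by
    rw [norm_toE_sq, hM]
    have : Cρ * Q * Cσᴴ * (Cρ * Q * Cσᴴ)ᴴ = Cρ * (Q * σ * Q) * Cρᴴ := by
      rw [conjTranspose_mul, conjTranspose_mul, conjTranspose_conjTranspose, hQh.eq, hCσ]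
      simp only [Matrix.mul_assoc]
    rw [this, trace_mul_cycle Cρ, ← hCρ, trace_mul_comm ρ, trace_mul_comm (Q * ρ)]
    simp only [Matrix.mul_assoc]
  -- each `‖M_a‖_F ≤ √p_a √q_a`
  have hT : ∀ a, ‖toE (Ma a)‖ ≤ √((E a * ρ).trace.re) * √((E a * σ).trace.re) := by
    intro a
    rw [norm_toE]
    have e : (Ma a * (Ma a)ᴴ).trace = (E a * σ * (E a * ρ)).trace := by
      rw [hMadef]
      dsimp only
      rw [conjTranspose_mul, conjTranspose_mul, conjTranspose_conjTranspose, (hE a).1.eq]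
      have : Cρ * E a * Cσᴴ * (Cσ * (E a * Cρᴴ)) = Cρ * (E a * σ * E a) * Cρᴴ := by
        rw [hCσ]; simp only [Matrix.mul_assoc]
      rw [this, trace_mul_cycle Cρ, ← hCρ, trace_mul_comm ρ]
      simp only [Matrix.mul_assoc]
    rw [e, ← Real.sqrt_mul (re_trace_mul_nonneg_of_posSemidef (hE a) hρ), mul_comm]
    exact Real.sqrt_le_sqrt (re_trace_mul_mul_mul_le (hE a) hσ hρ)
  rw [hL, toE_sum]
  have h0 : 0 ≤ ∑ a, √((E a * ρ).trace.re) * √((E a * σ).trace.re) :=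
    Finset.sum_nonneg fun a _ => mul_nonneg (Real.sqrt_nonneg _) (Real.sqrt_nonneg _)
  calc ‖∑ a, toE (Ma a)‖ ^ 2 ≤ (∑ a, ‖toE (Ma a)‖) ^ 2 := by
        gcongr; exact norm_sum_le _ _
    _ ≤ (∑ a, √((E a * ρ).trace.re) * √((E a * σ).trace.re)) ^ 2 := by
        gcongr with a _
        exact hT a

end FidelityBound

open FidelityBound CpsdFormulation

/-! ### Classical fidelity -/

/-- The (classical) **fidelity** `F(u,v) = Σ_i √u_i √v_i` of two nonnegative vectors (for
probability distributions: the fidelity `F(diag u, diag v)`, the Bhattacharyya coefficient).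
[cite: LeeWeiDeWolf2017, §2.3 (p05)] -/
def classicalFidelity {ι : Type*} [Fintype ι] (u v : ι → ℝ) : ℝ := ∑ i, √(u i) * √(v i)

/-- `F(u,v) ≥ 0`. [cite: LeeWeiDeWolf2017, §2.3 (p05)] -/
theorem classicalFidelity_nonneg {ι : Type*} [Fintype ι] (u v : ι → ℝ) : 0 ≤ classicalFidelity u v :=
  Finset.sum_nonneg fun _ _ => mul_nonneg (Real.sqrt_nonneg _) (Real.sqrt_nonneg _)

/-- `F(u,v) = F(v,u)`. [cite: LeeWeiDeWolf2017, §2.3 (p05)] -/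
theorem classicalFidelity_comm {ι : Type*} [Fintype ι] (u v : ι → ℝ) :
    classicalFidelity u v = classicalFidelity v u :=
  Finset.sum_congr rfl fun _ _ => mul_comm _ _

/-! ### Lee–Wei–de Wolf Theorem 19: `rank_psd(P) ≥ B₃(P)` -/

/-- **LWdW Theorem 19 for an explicit factorization.** If the column-stochastic `m × n` matrix `P`
has a psd factorization `P(i,j) = Tr(E_i F_j)` by complex Hermitian psd `r × r` matrices, then for
every probability vector `q` on the columns, `1 ≤ r · Σ_{s,t} q_s q_t F(P_s,P_t)²`, i.e.
`r ≥ 1 / Σ_{s,t} q_s q_t F(P_s,P_t)²`. [cite: LeeWeiDeWolf2017, Thm. 19 (p09)] -/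
theorem LeeWeiDeWolf2017_thm19_factors {m n r : ℕ} {P : Fin m → Fin n → ℝ}
    (E : Fin m → Matrix (Fin r) (Fin r) ℂ) (F : Fin n → Matrix (Fin r) (Fin r) ℂ)
    (hE : ∀ i, (E i).PosSemidef) (hF : ∀ j, (F j).PosSemidef)
    (hP : ∀ i j, ((P i j : ℝ) : ℂ) = (E i * F j).trace) (hcol : ∀ j, ∑ i, P i j = 1)
    (q : Fin n → ℝ) (hq : ∀ j, 0 ≤ q j) (hq1 : ∑ j, q j = 1) :
    (1 : ℝ) ≤ r * ∑ s, ∑ t, q s * q t * classicalFidelity (fun k => P k s) (fun k => P k t) ^ 2 := by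
  set Q : Matrix (Fin r) (Fin r) ℂ := ∑ i, E i with hQdef
  set Λ : Matrix (Fin r) (Fin r) ℂ := ∑ t, ((q t : ℝ) : ℂ) • F t with hΛdef
  have hQ : Q.PosSemidef := posSemidef_sum _ fun i _ => hE i
  have hΛ : Λ.PosSemidef :=
    posSemidef_sum _ fun t _ => (hF t).smul (Complex.zero_le_real.mpr (hq t))
  -- `Tr(Q Λ) = Σ_t q_t Σ_i P(i,t) = 1`
  have hQF : ∀ t, (Q * F t).trace = 1 := fun t => by
    rw [hQdef, Finset.sum_mul, trace_sum]
    simp_rw [← hP]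
    exact_mod_cast hcol t
  have h1 : (Q * Λ).trace = 1 := by
    rw [hΛdef, Finset.mul_sum, trace_sum]
    simp_rw [Matrix.mul_smul, trace_smul, hQF, smul_eq_mul, mul_one]
    exact_mod_cast hq1
  -- the dimension bound
  have hC := normSq_trace_mul_le_card_mul hQ hΛ
  rw [h1, norm_one, one_pow, Fintype.card_fin] at hC
  -- expand `Tr(QΛQΛ)`
  have hQΛ : Q * Λ = ∑ s, ((q s : ℝ) : ℂ) • (Q * F s) := by
    rw [hΛdef, Finset.mul_sum]
    simp_rw [Matrix.mul_smul]
  have e : (Q * Λ * (Q * Λ)).trace.re =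
      ∑ s, ∑ t, q s * q t * (Q * F s * (Q * F t)).trace.re := by
    rw [hQΛ, Finset.sum_mul, trace_sum, Complex.re_sum]
    refine Finset.sum_congr rfl fun s _ => ?_
    rw [Finset.mul_sum, trace_sum, Complex.re_sum]
    refine Finset.sum_congr rfl fun t _ => ?_
    rw [Matrix.smul_mul, Matrix.mul_smul, smul_smul, trace_smul, smul_eq_mul, ← Complex.ofReal_mul,
      Complex.re_ofReal_mul]
  rw [e] at hC
  refine hC.trans (mul_le_mul_of_nonneg_left (Finset.sum_le_sum fun s _ =>
    Finset.sum_le_sum fun t _ => mul_le_mul_of_nonneg_left ?_ (mul_nonneg (hq s) (hq t))) (Nat.cast_nonneg _))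
  have key := re_trace_le_sq_sum_sqrt E hE (hF s) (hF t)
  have hre : ∀ k j, (E k * F j).trace.re = P k j := fun k j => by rw [← hP, Complex.ofReal_re]
  simp_rw [hre] at key
  exact key

/-- **LWdW Theorem 19** (`rank_psd(P) ≥ B₃(P)`), as a named statement (p09, verbatim): "Definition 18.
For nonnegative stochastic matrix `P`, define `B₃(P) = max_q 1 / Σ_{i,j} q_i q_j F(P_i,P_j)²`, where
`P_i` is the `i`th column of `P` and the max is taken over probability distributions `q = {q_j}`.
Theorem 19. `rank_psd(P) ≥ B₃(P)`." Here `rank_psd` is the psd-rank with complex Hermitian psd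
factors (p05: "we allow the matrices of the PSD-factorization to be arbitrary Hermitian PSD matrices,
with complex-valued entries"; the real psd-rank is at least as large), "stochastic" means every
column of `P` sums to one, and `F` is the classical fidelity of columns. Typed multiplicatively:
every complex psd factorization of size `r` and every probability vector `q` satisfy
`1 ≤ r · Σ_{s,t} q_s q_t F(P_s,P_t)²`. [cite: LeeWeiDeWolf2017, Def. 18 and Thm. 19 (p09)] -/
def LeeWeiDeWolf2017_thm19 : Prop :=
  ∀ (m n r : ℕ) (P : Fin m → Fin n → ℝ), (∀ j, ∑ i, P i j = 1) →
    (∃ (E : Fin m → Matrix (Fin r) (Fin r) ℂ) (F : Fin n → Matrix (Fin r) (Fin r) ℂ),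
      (∀ i, (E i).PosSemidef) ∧ (∀ j, (F j).PosSemidef) ∧ ∀ i j, ((P i j : ℝ) : ℂ) = (E i * F j).trace) →
    ∀ q : Fin n → ℝ, (∀ j, 0 ≤ q j) → ∑ j, q j = 1 →
      (1 : ℝ) ≤ r * ∑ s, ∑ t, q s * q t * classicalFidelity (fun k => P k s) (fun k => P k t) ^ 2

/-- Discharge of `LeeWeiDeWolf2017_thm19`. [cite: LeeWeiDeWolf2017, Thm. 19 (p09)] -/
theorem LeeWeiDeWolf2017_thm19_holds : LeeWeiDeWolf2017_thm19 :=
  fun _ _ _ _ hcol ⟨E, F, hE, hF, hP⟩ q hq hq1 => LeeWeiDeWolf2017_thm19_factors E F hE hF hP hcol q hq hq1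

/-- `B₃` in division form: `1 / Σ_{s,t} q_s q_t F(P_s,P_t)² ≤ r` for every complex psd factorization of
size `r` and every probability vector `q`. [cite: LeeWeiDeWolf2017, Thm. 19 (p09)] -/
theorem LeeWeiDeWolf2017_thm19_inv_le {m n r : ℕ} {P : Fin m → Fin n → ℝ}
    (E : Fin m → Matrix (Fin r) (Fin r) ℂ) (F : Fin n → Matrix (Fin r) (Fin r) ℂ)
    (hE : ∀ i, (E i).PosSemidef) (hF : ∀ j, (F j).PosSemidef)
    (hP : ∀ i j, ((P i j : ℝ) : ℂ) = (E i * F j).trace) (hcol : ∀ j, ∑ i, P i j = 1)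
    (q : Fin n → ℝ) (hq : ∀ j, 0 ≤ q j) (hq1 : ∑ j, q j = 1) :
    (∑ s, ∑ t, q s * q t * classicalFidelity (fun k => P k s) (fun k => P k t) ^ 2)⁻¹ ≤ r := by
  have h := LeeWeiDeWolf2017_thm19_factors E F hE hF hP hcol q hq hq1
  have hS : 0 < ∑ s, ∑ t, q s * q t * classicalFidelity (fun k => P k s) (fun k => P k t) ^ 2 := by
    by_contra hS
    have : (r : ℝ) * ∑ s, ∑ t, q s * q t * classicalFidelity (fun k => P k s) (fun k => P k t) ^ 2 ≤ 0 :=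
      mul_nonpos_of_nonneg_of_nonpos (Nat.cast_nonneg _) (not_lt.mp hS)
    linarith
  rw [inv_eq_one_div, div_le_iff₀ hS]
  exact h

/-- **LWdW Theorem 19 for the real psd-rank** (`rank_psd^ℝ ≥ rank_psd ≥ B₃`, p05/p09): the tree's
real-symmetric factorizations `HasPsdFactorization P r` obey the same bound (a real psd factor is a
complex Hermitian psd factor). [cite: LeeWeiDeWolf2017, Thm. 19 (p09) and §2.1 (p05)] -/
theorem LeeWeiDeWolf2017_thm19_real {m n r : ℕ} {P : Fin m → Fin n → ℝ}
    (hPr : HasPsdFactorization P r) (hcol : ∀ j, ∑ i, P i j = 1)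
    (q : Fin n → ℝ) (hq : ∀ j, 0 ≤ q j) (hq1 : ∑ j, q j = 1) :
    (1 : ℝ) ≤ r * ∑ s, ∑ t, q s * q t * classicalFidelity (fun k => P k s) (fun k => P k t) ^ 2 := by
  obtain ⟨A, B, hA, hB, hPAB⟩ := hPr
  have hmap : ∀ {M : Matrix (Fin r) (Fin r) ℝ}, M.PosSemidef → (M.map ((↑) : ℝ → ℂ)).PosSemidef := by
    intro M hM
    obtain ⟨C, hC⟩ := CStarAlgebra.nonneg_iff_eq_star_mul_self.mp hM.nonneg
    rw [hC, star_eq_conjTranspose]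
    have : (Cᴴ * C).map ((↑) : ℝ → ℂ) = (C.map ((↑) : ℝ → ℂ))ᴴ * C.map ((↑) : ℝ → ℂ) := by
      rw [← Complex.coe_algebraMap]
      have hf : Function.Semiconj (⇑(algebraMap ℝ ℂ)) star star := fun x => by simp
      rw [Matrix.map_mul, conjTranspose_map _ hf]
    rw [this]
    exact posSemidef_conjTranspose_mul_self _
  refine LeeWeiDeWolf2017_thm19_factors (fun i => (A i).map ((↑) : ℝ → ℂ))
    (fun j => (B j).map ((↑) : ℝ → ℂ)) (fun i => hmap (hA i)) (fun j => hmap (hB j)) (fun i j => ?_)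
    hcol q hq hq1
  rw [hPAB]
  simp [Matrix.trace, Matrix.mul_apply, Complex.ofReal_sum, Complex.ofReal_mul]

/-- **LWdW Corollary 21** (`rank_psd(P) ≥ B₃'(P)`, rescaling; p09): "rescaling a nonnegative matrix by
multiplying its rows or columns with nonnegative numbers does not increase its PSD-rank", so for a
diagonal `D ≥ 0` one may apply `B₃` to the column-normalised `DP`: with `d_k ≥ 0`, column sums
`c_s = Σ_k d_k P(k,s) > 0` and `(DP)_s = (d_k P(k,s) / c_s)_k`, every complex psd factorization of `P`
of size `r` satisfies `1 ≤ r · Σ_{s,t} q_s q_t F((DP)_s,(DP)_t)²` (factors `d_k E_k`, `F_s / c_s`).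
[cite: LeeWeiDeWolf2017, Def. 20 and Cor. 21 (p09)] -/
theorem LeeWeiDeWolf2017_cor21_factors {m n r : ℕ} {P : Fin m → Fin n → ℝ}
    (E : Fin m → Matrix (Fin r) (Fin r) ℂ) (F : Fin n → Matrix (Fin r) (Fin r) ℂ)
    (hE : ∀ i, (E i).PosSemidef) (hF : ∀ j, (F j).PosSemidef)
    (hP : ∀ i j, ((P i j : ℝ) : ℂ) = (E i * F j).trace) (dw : Fin m → ℝ) (hdw : ∀ k, 0 ≤ dw k)
    (hc : ∀ s, 0 < ∑ k, dw k * P k s) (q : Fin n → ℝ) (hq : ∀ j, 0 ≤ q j) (hq1 : ∑ j, q j = 1) :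
    (1 : ℝ) ≤ r * ∑ s, ∑ t, q s * q t *
      classicalFidelity (fun k => dw k * P k s / ∑ k, dw k * P k s)
        (fun k => dw k * P k t / ∑ k, dw k * P k t) ^ 2 := by
  set c : Fin n → ℝ := fun s => ∑ k, dw k * P k s with hcdef
  refine LeeWeiDeWolf2017_thm19_factors (P := fun k s => dw k * P k s / c s)
    (fun k => ((dw k : ℝ) : ℂ) • E k) (fun s => (((c s)⁻¹ : ℝ) : ℂ) • F s)
    (fun k => (hE k).smul (Complex.zero_le_real.mpr (hdw k)))
    (fun s => (hF s).smul (Complex.zero_le_real.mpr (inv_nonneg.mpr (hc s).le)))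
    (fun k s => ?_) (fun s => ?_) q hq hq1
  · rw [Matrix.smul_mul, Matrix.mul_smul, smul_smul, trace_smul, ← hP, smul_eq_mul, div_eq_mul_inv]
    push_cast; ring
  · simp only [div_eq_mul_inv, ← Finset.sum_mul]
    exact mul_inv_cancel₀ (hc s).ne'

/-! ### Sikora–Varvitsiotis–Wei: a lower bound on `𝒟(p)` (equivalently, by PSVW Theorem 2, on the
cpsd-rank of the matrices in `CS_+ ∩ 𝒜(p)`) -/

variable {mA mB oA oB : ℕ}

/-- The Bob-side SVW sum `S_B(p; y₁,y₂; ξ) = Σ_{b₁,b₂} (Σ_a √p(a b₁|ξ(b₁,b₂) y₁) √p(a b₂|ξ(b₁,b₂) y₂))²`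
for a selection `ξ` of one Alice setting per pair `(b₁,b₂)`; the printed bound (9) uses
`min_x (…)²`, i.e. the minimising selection, and `f₁(p) = max_{y₁,y₂} [Σ_{b₁,b₂} min_x (…)²]⁻¹ =
sup_{y₁,y₂,ξ} S_B(p; y₁,y₂; ξ)⁻¹`. [cite: SikoraVarvitsiotisWei2016, eq. (9) (p04)] -/
def svwSumB (p : Fin mA → Fin mB → Fin oA → Fin oB → ℝ) (y₁ y₂ : Fin mB)
    (ξ : Fin oB → Fin oB → Fin mA) : ℝ :=
  ∑ b₁, ∑ b₂, classicalFidelity (fun a => p (ξ b₁ b₂) y₁ a b₁) (fun a => p (ξ b₁ b₂) y₂ a b₂) ^ 2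

/-- The Alice-side SVW sum `S_A(p; x₁,x₂; η) = Σ_{a₁,a₂} (Σ_b √p(a₁ b|x₁ η(a₁,a₂)) √p(a₂ b|x₂ η(a₁,a₂)))²`
(bound (10): `f₂(p) = sup_{x₁,x₂,η} S_A(p; x₁,x₂; η)⁻¹`). [cite: SikoraVarvitsiotisWei2016, eq. (10) (p04)] -/
def svwSumA (p : Fin mA → Fin mB → Fin oA → Fin oB → ℝ) (x₁ x₂ : Fin mA)
    (η : Fin oA → Fin oA → Fin mB) : ℝ :=
  ∑ a₁, ∑ a₂, classicalFidelity (fun b => p x₁ (η a₁ a₂) a₁ b) (fun b => p x₂ (η a₁ a₂) a₂ b) ^ 2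

/-- `S_B ≥ 0`. [cite: SikoraVarvitsiotisWei2016, eq. (9) (p04)] -/
theorem svwSumB_nonneg (p : Fin mA → Fin mB → Fin oA → Fin oB → ℝ) (y₁ y₂ : Fin mB)
    (ξ : Fin oB → Fin oB → Fin mA) : 0 ≤ svwSumB p y₁ y₂ ξ :=
  Finset.sum_nonneg fun _ _ => Finset.sum_nonneg fun _ _ => sq_nonneg _

/-- `S_A ≥ 0`. [cite: SikoraVarvitsiotisWei2016, eq. (10) (p04)] -/
theorem svwSumA_nonneg (p : Fin mA → Fin mB → Fin oA → Fin oB → ℝ) (x₁ x₂ : Fin mA)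
    (η : Fin oA → Fin oA → Fin mB) : 0 ≤ svwSumA p x₁ x₂ η :=
  Finset.sum_nonneg fun _ _ => Finset.sum_nonneg fun _ _ => sq_nonneg _

/-- **The SVW bound at the level of cpsd factors** (the heart of the Letter, p03–p04): if
`p(ab|xy) = Tr(X_{xa} Y_{yb})` with Hermitian psd `d × d` factors all of whose row sums equal `K`,
`Tr K² = 1` (the Sikora–Varvitsiotis factor form of a `d`-dimensional representation, [VS15] =
`exists_cpsd_of_hasQuantumRep`), then `1 ≤ d · S_B(p; y₁,y₂; ξ)`. Printed route: `U` with `UKU† = I`,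
POVM `E' = UEU†`, states `F'_{yb}`, `ρ_{y₁} = ρ_{y₂}` (7), `Tr ρ² ≥ 1/d` (8), fidelity monotonicity
(5)–(6). Here: `1 = (Tr K²)² ≤ d · Tr K⁴ = d · Σ_{b₁,b₂} Tr(K Y_{y₁b₁} K Y_{y₂b₂})` and each term is
`≤ (Σ_a √Tr(X_{xa}Y_{y₁b₁}) √Tr(X_{xa}Y_{y₂b₂}))²` for any `x` since `K = Σ_a X_{xa}`
(`FidelityBound.re_trace_le_sq_sum_sqrt`); no inversion of `K` is needed.
[cite: SikoraVarvitsiotisWei2016, eqs. (4)–(9) and Theorem (p03–p04)] -/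
theorem one_le_mul_svwSumB_of_factors {d : ℕ} {p : Fin mA → Fin mB → Fin oA → Fin oB → ℝ}
    (K : Matrix (Fin d) (Fin d) ℂ) (hK1 : (K * K).trace = 1)
    (X : Fin mA → Fin oA → Matrix (Fin d) (Fin d) ℂ) (Y : Fin mB → Fin oB → Matrix (Fin d) (Fin d) ℂ)
    (hX : ∀ x a, (X x a).PosSemidef) (hY : ∀ y b, (Y y b).PosSemidef) (hXs : ∀ x, ∑ a, X x a = K)
    (hYs : ∀ y, ∑ b, Y y b = K) (hp : ∀ x y a b, ((p x y a b : ℝ) : ℂ) = (X x a * Y y b).trace)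
    (y₁ y₂ : Fin mB) (ξ : Fin oB → Fin oB → Fin mA) : (1 : ℝ) ≤ d * svwSumB p y₁ y₂ ξ := by
  have hK : K.PosSemidef := by rw [← hYs y₁]; exact posSemidef_sum _ fun b _ => hY y₁ b
  have hC := normSq_trace_mul_le_card_mul hK hK
  rw [hK1, norm_one, one_pow, Fintype.card_fin] at hC
  have e : (K * K * (K * K)).trace.re = ∑ b₁, ∑ b₂, (K * Y y₁ b₁ * (K * Y y₂ b₂)).trace.re := by
    conv_lhs => rw [show K * K * (K * K) = K * (∑ b₁, Y y₁ b₁) * (K * ∑ b₂, Y y₂ b₂) by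
      rw [hYs, hYs]]
    rw [Finset.mul_sum, Finset.sum_mul, trace_sum, Complex.re_sum]
    refine Finset.sum_congr rfl fun b₁ _ => ?_
    rw [Finset.mul_sum, Finset.mul_sum, trace_sum, Complex.re_sum]
  rw [e] at hC
  refine hC.trans (mul_le_mul_of_nonneg_left (Finset.sum_le_sum fun b₁ _ =>
    Finset.sum_le_sum fun b₂ _ => ?_) (Nat.cast_nonneg _))
  have key := re_trace_le_sq_sum_sqrt (X (ξ b₁ b₂)) (hX _) (hY y₁ b₁) (hY y₂ b₂)
  rw [hXs] at key
  have hre : ∀ x y a b, (X x a * Y y b).trace.re = p x y a b := fun x y a b => by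
    rw [← hp, Complex.ofReal_re]
  simp_rw [hre] at key
  exact key

/-- Extracting Sikora–Varvitsiotis factors with a common row sum from `R ∈ CS_+ ∩ 𝒜(p)` of
cpsd-rank `≤ d` (SV Lemma 3.6 (a): conditions (1)–(3) force `Σ_a X_{xa} = Σ_b Y_{yb}`), anchored
at a Bob setting `y₀`. [cite: SikoraVarvitsiotis2016, Lemma 3.6 (a) (p12)] -/
private theorem exists_factors_of_cpsd {d : ℕ} {p : Fin mA → Fin mB → Fin oA → Fin oB → ℝ}
    {R : Matrix (BellIndex mA mB oA oB) (BellIndex mA mB oA oB) ℝ} (hR : R ∈ behaviorAffine p)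
    (hRd : HasCpsdFactorization R d) (y₀ : Fin mB) :
    ∃ (K : Matrix (Fin d) (Fin d) ℂ) (X : Fin mA → Fin oA → Matrix (Fin d) (Fin d) ℂ)
      (Y : Fin mB → Fin oB → Matrix (Fin d) (Fin d) ℂ), (K * K).trace = 1 ∧
      (∀ x a, (X x a).PosSemidef) ∧ (∀ y b, (Y y b).PosSemidef) ∧ (∀ x, ∑ a, X x a = K) ∧
      (∀ y, ∑ b, Y y b = K) ∧ ∀ x y a b, ((p x y a b : ℝ) : ℂ) = (X x a * Y y b).trace := by
  obtain ⟨_, h1, h2, h3, h4⟩ := hR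
  obtain ⟨F, hF, hRF⟩ := hRd
  set X : Fin mA → Fin oA → Matrix (Fin d) (Fin d) ℂ := fun x a => F (.inl (x, a)) with hXdef
  set Y : Fin mB → Fin oB → Matrix (Fin d) (Fin d) ℂ := fun y b => F (.inr (y, b)) with hYdef
  have hX : ∀ x a, (X x a).PosSemidef := fun x a => hF _
  have hY : ∀ y b, (Y y b).PosSemidef := fun y b => hF _
  have hSh : ∀ x, (∑ a, X x a).IsHermitian := fun x => (posSemidef_sum _ fun a _ => hX x a).1
  have hTh : ∀ y, (∑ b, Y y b).IsHermitian := fun y => (posSemidef_sum _ fun b _ => hY y b).1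
  have c1 : ∀ x x', ((∑ a, X x a) * ∑ a', X x' a').trace = 1 := fun x x' => by
    rw [Finset.sum_mul]
    simp only [Finset.mul_sum, trace_sum, hXdef, ← hRF]
    exact_mod_cast h1 x x'
  have c2 : ∀ x y, ((∑ a, X x a) * ∑ b, Y y b).trace = 1 := fun x y => by
    rw [Finset.sum_mul]
    simp only [Finset.mul_sum, trace_sum, hXdef, hYdef, ← hRF]
    exact_mod_cast h2 x y
  have c3 : ∀ y y', ((∑ b, Y y b) * ∑ b', Y y' b').trace = 1 := fun y y' => by
    rw [Finset.sum_mul]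
    simp only [Finset.mul_sum, trace_sum, hYdef, ← hRF]
    exact_mod_cast h3 y y'
  have hp : ∀ x y a b, ((p x y a b : ℝ) : ℂ) = (X x a * Y y b).trace := fun x y a b => by
    rw [← h4, hRF]
  refine ⟨∑ b, Y y₀ b, X, Y, c3 y₀ y₀, hX, hY, fun x => ?_, fun y => ?_, hp⟩
  · exact eq_of_trace_eq_one' (hSh x) (hTh y₀) (c1 x x) (c2 x y₀) (c3 y₀ y₀)
  · exact eq_of_trace_eq_one' (hTh y) (hTh y₀) (c3 y y) (c3 y y₀) (c3 y₀ y₀)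

/-- **SVW bound for cpsd matrices in `𝒜(p)`** (PSVW Theorem 2 language): if `R ∈ 𝒜(p)` has a
`CS_+`-factorization of size `d`, then `1 ≤ d · S_B(p; y₁,y₂; ξ)` — a lower bound
`cpsd-rank(R) ≥ f₁(p)` for every `R ∈ CS_+ ∩ 𝒜(p)`.
[cite: SikoraVarvitsiotisWei2016, Theorem (p04); PrakashEtAl2017, Thm. 2 (p05)] -/
theorem one_le_mul_svwSumB_of_hasCpsdFactorization {d : ℕ} {p : Fin mA → Fin mB → Fin oA → Fin oB → ℝ}
    {R : Matrix (BellIndex mA mB oA oB) (BellIndex mA mB oA oB) ℝ} (hR : R ∈ behaviorAffine p)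
    (hRd : HasCpsdFactorization R d) (y₁ y₂ : Fin mB) (ξ : Fin oB → Fin oB → Fin mA) :
    (1 : ℝ) ≤ d * svwSumB p y₁ y₂ ξ := by
  obtain ⟨K, X, Y, hK1, hX, hY, hXs, hYs, hp⟩ := exists_factors_of_cpsd hR hRd y₁
  exact one_le_mul_svwSumB_of_factors K hK1 X Y hX hY hXs hYs hp y₁ y₂ ξ

/-- The Alice-side version: `1 ≤ d · S_A(p; x₁,x₂; η)` for `R ∈ CS_+ ∩ 𝒜(p)` of cpsd-rank `≤ d`
("we could have transformed the matrices `F_{yb}` into the measurements instead", p04: swap the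
roles of the two factor families). [cite: SikoraVarvitsiotisWei2016, eq. (10) and Theorem (p04)] -/
theorem one_le_mul_svwSumA_of_hasCpsdFactorization {d : ℕ} {p : Fin mA → Fin mB → Fin oA → Fin oB → ℝ}
    {R : Matrix (BellIndex mA mB oA oB) (BellIndex mA mB oA oB) ℝ} (hR : R ∈ behaviorAffine p)
    (hRd : HasCpsdFactorization R d) (x₁ x₂ : Fin mA) (η : Fin oA → Fin oA → Fin mB) :
    (1 : ℝ) ≤ d * svwSumA p x₁ x₂ η := by
  -- the swapped behaviour `p'(ba|yx) = p(ab|xy)` has the swapped factors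
  obtain ⟨_, h1, h2, h3, h4⟩ := hR
  obtain ⟨F, hF, hRF⟩ := hRd
  set X : Fin mA → Fin oA → Matrix (Fin d) (Fin d) ℂ := fun x a => F (.inl (x, a)) with hXdef
  set Y : Fin mB → Fin oB → Matrix (Fin d) (Fin d) ℂ := fun y b => F (.inr (y, b)) with hYdef
  have hX : ∀ x a, (X x a).PosSemidef := fun x a => hF _
  have hY : ∀ y b, (Y y b).PosSemidef := fun y b => hF _
  have hSh : ∀ x, (∑ a, X x a).IsHermitian := fun x => (posSemidef_sum _ fun a _ => hX x a).1
  have hTh : ∀ y, (∑ b, Y y b).IsHermitian := fun y => (posSemidef_sum _ fun b _ => hY y b).1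
  have c1 : ∀ x x', ((∑ a, X x a) * ∑ a', X x' a').trace = 1 := fun x x' => by
    rw [Finset.sum_mul]
    simp only [Finset.mul_sum, trace_sum, hXdef, ← hRF]
    exact_mod_cast h1 x x'
  have c2 : ∀ x y, ((∑ a, X x a) * ∑ b, Y y b).trace = 1 := fun x y => by
    rw [Finset.sum_mul]
    simp only [Finset.mul_sum, trace_sum, hXdef, hYdef, ← hRF]
    exact_mod_cast h2 x y
  have c3 : ∀ y y', ((∑ b, Y y b) * ∑ b', Y y' b').trace = 1 := fun y y' => by
    rw [Finset.sum_mul]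
    simp only [Finset.mul_sum, trace_sum, hYdef, ← hRF]
    exact_mod_cast h3 y y'
  have hp' : ∀ y x b a, ((p x y a b : ℝ) : ℂ) = (Y y b * X x a).trace :=
    fun y x b a => by rw [trace_mul_comm, ← h4, hRF]
  have hYs : ∀ y, ∑ b, Y y b = ∑ a, X x₁ a := fun y =>
    eq_of_trace_eq_one' (hTh y) (hSh x₁) (c3 y y) (by rw [trace_mul_comm]; exact c2 x₁ y) (c1 x₁ x₁)
  have hXs : ∀ x, ∑ a, X x a = ∑ a, X x₁ a := fun x =>
    eq_of_trace_eq_one' (hSh x) (hSh x₁) (c1 x x) (c1 x x₁) (c1 x₁ x₁)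
  exact one_le_mul_svwSumB_of_factors (p := fun y x b a => p x y a b) (∑ a, X x₁ a) (c1 x₁ x₁)
    Y X hY hX hYs hXs hp' x₁ x₂ η

/-- **SVW lower bound, Bob side, for a `d`-dimensional representation**: `p(ab|xy) = Tr((M⊗N)ρ)`
on `ℂ^d ⊗ ℂ^d` forces `1 ≤ d · S_B(p; y₁,y₂; ξ)` for all `y₁, y₂, ξ` (so `d ≥ f₁(p)`).
[cite: SikoraVarvitsiotisWei2016, eq. (9) and Theorem (p04)] -/
theorem one_le_mul_svwSumB_of_hasQuantumRep {d : ℕ} {p : Fin mA → Fin mB → Fin oA → Fin oB → ℝ}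
    (h : HasQuantumRep p d) (y₁ y₂ : Fin mB) (ξ : Fin oB → Fin oB → Fin mA) :
    (1 : ℝ) ≤ d * svwSumB p y₁ y₂ ξ := by
  obtain ⟨R, hR, hRd⟩ := exists_cpsd_of_hasQuantumRep h
  exact one_le_mul_svwSumB_of_hasCpsdFactorization hR hRd y₁ y₂ ξ

/-- **SVW lower bound, Alice side, for a `d`-dimensional representation**: `1 ≤ d · S_A(p; x₁,x₂; η)`
(so `d ≥ f₂(p)`). [cite: SikoraVarvitsiotisWei2016, eq. (10) and Theorem (p04)] -/
theorem one_le_mul_svwSumA_of_hasQuantumRep {d : ℕ} {p : Fin mA → Fin mB → Fin oA → Fin oB → ℝ}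
    (h : HasQuantumRep p d) (x₁ x₂ : Fin mA) (η : Fin oA → Fin oA → Fin mB) :
    (1 : ℝ) ≤ d * svwSumA p x₁ x₂ η := by
  obtain ⟨R, hR, hRd⟩ := exists_cpsd_of_hasQuantumRep h
  exact one_le_mul_svwSumA_of_hasCpsdFactorization hR hRd x₁ x₂ η

/-- **SVW Theorem for `𝒟(p)`, Bob side**: for `p ∈ 𝒬`, `1 ≤ 𝒟(p) · S_B(p; y₁,y₂; ξ)`.
[cite: SikoraVarvitsiotisWei2016, Theorem (p04)] -/
theorem one_le_quantumDim_mul_svwSumB {p : Fin mA → Fin mB → Fin oA → Fin oB → ℝ}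
    (hp : p ∈ quantumBehaviors mA mB oA oB) (y₁ y₂ : Fin mB) (ξ : Fin oB → Fin oB → Fin mA) :
    (1 : ℝ) ≤ quantumDim p * svwSumB p y₁ y₂ ξ :=
  one_le_mul_svwSumB_of_hasQuantumRep (hasQuantumRep_quantumDim hp) y₁ y₂ ξ

/-- **SVW Theorem for `𝒟(p)`, Alice side**: for `p ∈ 𝒬`, `1 ≤ 𝒟(p) · S_A(p; x₁,x₂; η)`.
[cite: SikoraVarvitsiotisWei2016, Theorem (p04)] -/
theorem one_le_quantumDim_mul_svwSumA {p : Fin mA → Fin mB → Fin oA → Fin oB → ℝ}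
    (hp : p ∈ quantumBehaviors mA mB oA oB) (x₁ x₂ : Fin mA) (η : Fin oA → Fin oA → Fin mB) :
    (1 : ℝ) ≤ quantumDim p * svwSumA p x₁ x₂ η :=
  one_le_mul_svwSumA_of_hasQuantumRep (hasQuantumRep_quantumDim hp) x₁ x₂ η

/-- From `1 ≤ d · S` with `S ≥ 0`: `⌈S⁻¹⌉ ≤ d` (the integer rounding "`⌈a⌉` is the least integer
`t ≥ a`" of the Theorem, p04). [cite: SikoraVarvitsiotisWei2016, Theorem (p04)] -/
private theorem ceil_inv_le_of_one_le_mul {d : ℕ} {S : ℝ} (h : (1 : ℝ) ≤ d * S) : ⌈S⁻¹⌉₊ ≤ d := by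
  have hS : 0 < S := by
    by_contra hS
    have : (d : ℝ) * S ≤ 0 := mul_nonpos_of_nonneg_of_nonpos (Nat.cast_nonneg _) (not_lt.mp hS)
    linarith
  refine Nat.ceil_le.mpr ?_
  rw [inv_eq_one_div, div_le_iff₀ hS]
  exact h

/-- **Witnessing non-quantumness** (p05, "Witnessing non-quantumness": "`f₁(p) = +∞` yielding an
alternative proof that it has no finite-dimensional quantum representation"): if some
`S_B(p; y₁,y₂; ξ)` vanishes then `p ∉ 𝒬`. [cite: SikoraVarvitsiotisWei2016, p05] -/
theorem not_mem_quantumBehaviors_of_svwSumB_eq_zero {p : Fin mA → Fin mB → Fin oA → Fin oB → ℝ}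
    {y₁ y₂ : Fin mB} {ξ : Fin oB → Fin oB → Fin mA} (h0 : svwSumB p y₁ y₂ ξ = 0) :
    p ∉ quantumBehaviors mA mB oA oB := fun hp => by
  have := one_le_quantumDim_mul_svwSumB hp y₁ y₂ ξ
  rw [h0, mul_zero] at this
  exact absurd this (by norm_num)

/-- **Sikora–Varvitsiotis–Wei, Theorem** (PRL 117 (2016) 060401, p04, verbatim): "For any quantum
correlation `p` we have that `𝒟(p) ≥ ⌈max{f₁(p), f₂(p)}⌉`, where `f₁(p)` and `f₂(p)` denote the
expressions given in (9) and (10) respectively, and `⌈a⌉` is the least integer `t` such that `t ≥ a`":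
(9) `f₁(p) = max_{y₁,y₂} [Σ_{b₁,b₂} min_x (Σ_a √p(ab₁|xy₁) √p(ab₂|xy₂))²]⁻¹`, (10) `f₂(p) =
max_{x₁,x₂} [Σ_{a₁,a₂} min_y (Σ_b √p(a₁b|x₁y) √p(a₂b|x₂y))²]⁻¹`. Typed with the minimum over `x`
(resp. `y`) replaced by an arbitrary selection `ξ(b₁,b₂)` (resp. `η(a₁,a₂)`), which is the same
supremum: for every `p ∈ 𝒬`, `⌈S_B(p; y₁,y₂; ξ)⁻¹⌉ ≤ 𝒟(p)` and `⌈S_A(p; x₁,x₂; η)⁻¹⌉ ≤ 𝒟(p)` for all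
settings and selections (`𝒟(p)` = `quantumDim`, PSVW p05 = the Letter's `𝒟(p)`, p02).
[cite: SikoraVarvitsiotisWei2016, Theorem and eqs. (9)–(10) (p04)] -/
def SikoraVarvitsiotisWei2016_thm : Prop :=
  ∀ (mA mB oA oB : ℕ) (p : Fin mA → Fin mB → Fin oA → Fin oB → ℝ), p ∈ quantumBehaviors mA mB oA oB →
    (∀ (y₁ y₂ : Fin mB) (ξ : Fin oB → Fin oB → Fin mA), ⌈(svwSumB p y₁ y₂ ξ)⁻¹⌉₊ ≤ quantumDim p) ∧
    ∀ (x₁ x₂ : Fin mA) (η : Fin oA → Fin oA → Fin mB), ⌈(svwSumA p x₁ x₂ η)⁻¹⌉₊ ≤ quantumDim p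

/-- Discharge of `SikoraVarvitsiotisWei2016_thm`. [cite: SikoraVarvitsiotisWei2016, Theorem (p04)] -/
theorem SikoraVarvitsiotisWei2016_thm_holds : SikoraVarvitsiotisWei2016_thm := fun _ _ _ _ _ hp =>
  ⟨fun y₁ y₂ ξ => ceil_inv_le_of_one_le_mul (one_le_quantumDim_mul_svwSumB hp y₁ y₂ ξ),
    fun x₁ x₂ η => ceil_inv_le_of_one_le_mul (one_le_quantumDim_mul_svwSumA hp x₁ x₂ η)⟩

/-- The printed `min_x` form of (9): for `p ∈ 𝒬` in a scenario with at least one Alice setting,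
`1 ≤ 𝒟(p) · Σ_{b₁,b₂} min_x (Σ_a √p(ab₁|xy₁) √p(ab₂|xy₂))²`.
[cite: SikoraVarvitsiotisWei2016, eq. (9) and Theorem (p04)] -/
theorem one_le_quantumDim_mul_sum_iInf {p : Fin mA → Fin mB → Fin oA → Fin oB → ℝ}
    (hp : p ∈ quantumBehaviors mA mB oA oB) (hmA : 0 < mA) (y₁ y₂ : Fin mB) :
    (1 : ℝ) ≤ quantumDim p * ∑ b₁, ∑ b₂,
      ⨅ x : Fin mA, classicalFidelity (fun a => p x y₁ a b₁) (fun a => p x y₂ a b₂) ^ 2 := by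
  haveI : Nonempty (Fin mA) := ⟨⟨0, hmA⟩⟩
  choose ξ hξ using fun b₁ b₂ : Fin oB => exists_eq_ciInf_of_finite
    (f := fun x : Fin mA => classicalFidelity (fun a => p x y₁ a b₁) (fun a => p x y₂ a b₂) ^ 2)
  have h := one_le_quantumDim_mul_svwSumB hp y₁ y₂ ξ
  simp only [svwSumB, hξ] at h
  exact h

/-! ### Application: the generalised PR box has no finite-dimensional quantum representation -/

/-- **The generalised Popescu–Rohrlich box** (p05, (13), verbatim): "in the setting `X = Y = {0,1}`,
`A = B = {0,1,…,d−1}` given by `p(ab|xy) = 1/d` if `xy = (b − a) mod d`, `0` if `xy ≠ (b − a) mod d`"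
(outcomes typed as `Fin D`, subtraction in `ℤ/D`). [cite: SikoraVarvitsiotisWei2016, eq. (13) (p05)] -/
def prBox (D : ℕ) : Fin 2 → Fin 2 → Fin D → Fin D → ℝ := fun x y a b =>
  if ((b - a : Fin D) : ℕ) = (x : ℕ) * (y : ℕ) then 1 / D else 0

/-- For the PR box, `S_B(p; 0,1; ξ) = 0` with the selection `ξ(b₁,b₂) = 1` if `b₁ = b₂` and `0`
otherwise: `p(ab₁|x0) ≠ 0` forces `a = b₁`, and then `p(b₁b₂|x1) = 0` for this `x` ("we can readily
verify that `f₁(p) = +∞`", p05). [cite: SikoraVarvitsiotisWei2016, p05 (Witnessing non-quantumness)] -/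
theorem svwSumB_prBox_eq_zero {D : ℕ} (hD : 2 ≤ D) :
    svwSumB (prBox D) 0 1 (fun b₁ b₂ => if ((b₂ - b₁ : Fin D) : ℕ) = 0 then 1 else 0) = 0 := by
  haveI : NeZero D := ⟨by omega⟩
  refine Finset.sum_eq_zero fun b₁ _ => Finset.sum_eq_zero fun b₂ _ => ?_
  rw [sq_eq_zero_iff]
  refine Finset.sum_eq_zero fun a _ => ?_
  dsimp only
  rcases eq_or_ne a b₁ with rfl | hab
  · -- `a = b₁`: the second factor vanishes
    suffices h : prBox D (if ((b₂ - a : Fin D) : ℕ) = 0 then 1 else 0) 1 a b₂ = 0 by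
      rw [h, Real.sqrt_zero, mul_zero]
    unfold prBox
    split_ifs with h0 h1 h2
    · exact absurd h1 (by rw [h0]; norm_num)
    · rfl
    · exact absurd h2 (by simpa using h0)
    · rfl
  · -- `a ≠ b₁`: the first factor vanishes
    suffices h : prBox D (if ((b₂ - b₁ : Fin D) : ℕ) = 0 then 1 else 0) 0 a b₁ = 0 by
      rw [h, Real.sqrt_zero, zero_mul]
    unfold prBox
    rw [if_neg]
    rw [Fin.val_zero, mul_zero, Fin.val_eq_zero_iff, sub_eq_zero]
    exact fun h => hab h.symm

/-- **"An alternative proof that [the PR box] has no finite-dimensional quantum representation"**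
(p05): `prBox D ∉ 𝒬` for `D ≥ 2`. [cite: SikoraVarvitsiotisWei2016, p05 (Witnessing non-quantumness)] -/
theorem prBox_not_mem_quantumBehaviors {D : ℕ} (hD : 2 ≤ D) : prBox D ∉ quantumBehaviors 2 2 D D :=
  not_mem_quantumBehaviors_of_svwSumB_eq_zero (svwSumB_prBox_eq_zero hD)

/-! ### Relation to psd-rank (p05): the correlation matrix `(p(ab|xy))_{(x,a),(y,b)}` -/

/-- Trace is invariant under re-indexing along an equivalence. [folklore] -/
private theorem trace_submatrix_equiv' {p q : Type*} [Fintype p] [Fintype q] (X : Matrix q q ℝ)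
    (e : p ≃ q) : (X.submatrix e e).trace = X.trace := by
  simp only [trace, diag_apply, submatrix_apply]
  exact Fintype.sum_equiv e _ _ fun _ => rfl

/-- **"For general Bell scenarios … the PSD-rank of the matrix `Σ_{a,b,x,y} p(ab|xy) |xa⟩⟨yb|` is a
lower bound on `𝒟(p)`"** (p05), complex form: a `d`-dimensional representation yields complex
Hermitian psd `d × d` factors `E_{xa}, F_{yb}` with `p(ab|xy) = Tr(E_{xa} F_{yb})` (the
Sikora–Varvitsiotis factors). [cite: SikoraVarvitsiotisWei2016, p05 (Relation to PSD-rank); SikoraVarvitsiotis2016, Thm. 3.2 (p11)] -/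
theorem exists_psdFactors_of_hasQuantumRep {d : ℕ} {p : Fin mA → Fin mB → Fin oA → Fin oB → ℝ}
    (h : HasQuantumRep p d) :
    ∃ (E : Fin mA × Fin oA → Matrix (Fin d) (Fin d) ℂ) (F : Fin mB × Fin oB → Matrix (Fin d) (Fin d) ℂ),
      (∀ xa, (E xa).PosSemidef) ∧ (∀ yb, (F yb).PosSemidef) ∧
        ∀ xa yb, ((p xa.1 yb.1 xa.2 yb.2 : ℝ) : ℂ) = (E xa * F yb).trace := by
  obtain ⟨R, hR, hRd⟩ := exists_cpsd_of_hasQuantumRep h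
  obtain ⟨_, -, -, -, h4⟩ := hR
  obtain ⟨G, hG, hRG⟩ := hRd
  exact ⟨fun xa => G (.inl xa), fun yb => G (.inr yb), fun xa => hG _, fun yb => hG _,
    fun xa yb => by rw [← hRG, h4]⟩

/-- The same in the tree's (FGPRT, real-symmetric) psd-rank: a `d`-dimensional representation gives
`rank_psd ≤ 2d` for the real matrix `(p(ab|xy))_{(x,a),(y,b)}` (realification `T(P) = [Re P, −Im P;
Im P, Re P]` of PSVW §3.1, `Tr(T(P)T(Q)) = 2 Re Tr(PQ)`), so `rank_psd ≤ 2 𝒟(p)`.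
[cite: SikoraVarvitsiotisWei2016, p05 (Relation to PSD-rank); PrakashEtAl2017, §3.1 (p10) and §3.3.2 (p11–p12)] -/
theorem hasPsdFactorization_of_hasQuantumRep {d : ℕ} {p : Fin mA → Fin mB → Fin oA → Fin oB → ℝ}
    (h : HasQuantumRep p d) :
    HasPsdFactorization (fun (xa : Fin mA × Fin oA) (yb : Fin mB × Fin oB) => p xa.1 yb.1 xa.2 yb.2)
      (2 * d) := by
  obtain ⟨E, F, hE, hF, hp⟩ := exists_psdFactors_of_hasQuantumRep h
  let T : Matrix (Fin d) (Fin d) ℂ → Matrix (Fin d ⊕ Fin d) (Fin d ⊕ Fin d) ℝ := fun Q =>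
    Matrix.fromBlocks (Q.map Complex.re) (-(Q.map Complex.im)) (Q.map Complex.im) (Q.map Complex.re)
  let e : Fin (2 * d) ≃ Fin d ⊕ Fin d := (finCongr (two_mul d)).trans finSumFinEquiv.symm
  refine ⟨fun xa => ((1 / 2 : ℝ) • T (E xa)).submatrix e e, fun yb => (T (F yb)).submatrix e e,
    fun xa => ?_, fun yb => ?_, fun xa yb => ?_⟩
  · exact (posSemidef_submatrix_equiv e).mpr ((posSemidef_realify (hE xa)).smul (by norm_num))
  · exact (posSemidef_submatrix_equiv e).mpr (posSemidef_realify (hF yb))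
  · rw [submatrix_mul_equiv, trace_submatrix_equiv', Matrix.smul_mul, trace_smul, smul_eq_mul]
    show p xa.1 yb.1 xa.2 yb.2 = 1 / 2 * (T (E xa) * T (F yb)).trace
    rw [trace_realify_mul_realify, ← hp, Complex.ofReal_re]
    ring

/-- Hence `rank_psd((p(ab|xy))_{(x,a),(y,b)}) ≤ 2 𝒟(p)` for `p ∈ 𝒬` (real psd-rank; `≤ 𝒟(p)` with
complex factors). [cite: SikoraVarvitsiotisWei2016, p05 (Relation to PSD-rank)] -/
theorem hasPsdFactorization_two_mul_quantumDim {p : Fin mA → Fin mB → Fin oA → Fin oB → ℝ}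
    (hp : p ∈ quantumBehaviors mA mB oA oB) :
    HasPsdFactorization (fun (xa : Fin mA × Fin oA) (yb : Fin mB × Fin oB) => p xa.1 yb.1 xa.2 yb.2)
      (2 * quantumDim p) :=
  hasPsdFactorization_of_hasQuantumRep (hasQuantumRep_quantumDim hp)

/-! ### Lee–Wei–de Wolf Lemma 17 and the bounds `B₄` (Theorem 24), `B₅` (Theorem 29) for the real
psd-rank (appended)

LWdW normalise a size-optimal factorization to `Σ_i E_i = I`, `Tr F_j = 1` (Lemma 17, using the
minimality of the size). For the tree's real-symmetric factorizations (`HasPsdFactorization`, LWdW's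
"real PSD-rank" `rank_psd^ℝ ≥ rank_psd`, p05) the same normal form holds for EVERY factorization of
size `r`, by the congruence normalisation `exists_posSemidef_sum_eq_one_congr` of
`PsdRankBasicProperties.lean` (`A_i = Rᵀ F_i R`, `Σ_i F_i = I_r`; then `ρ_j = R B_j Rᵀ`); with it
Theorems 24 and 29 follow as printed. NOT typed: the complex-factor (`rank_psd`) versions of Lemma 17
and Theorems 24, 29 as printed (they need the complex analogue of the congruence normalisation), and
the rescaled variants `B₄'`, `B₅'` (Definitions 25, 30 / Corollaries 26, 31). -/

section RealBounds

variable {m n r : ℕ}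

/-- A real psd matrix is a complex Hermitian psd matrix (entrywise coercion). [folklore] -/
private theorem posSemidef_map_ofReal {M : Matrix (Fin r) (Fin r) ℝ} (hM : M.PosSemidef) :
    (M.map ((↑) : ℝ → ℂ)).PosSemidef := by
  obtain ⟨C, hC⟩ := CStarAlgebra.nonneg_iff_eq_star_mul_self.mp hM.nonneg
  rw [hC, star_eq_conjTranspose]
  have : (Cᴴ * C).map ((↑) : ℝ → ℂ) = (C.map ((↑) : ℝ → ℂ))ᴴ * C.map ((↑) : ℝ → ℂ) := by
    rw [← Complex.coe_algebraMap]
    have hf : Function.Semiconj (⇑(algebraMap ℝ ℂ)) star star := fun x => by simp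
    rw [Matrix.map_mul, conjTranspose_map _ hf]
  rw [this]
  exact posSemidef_conjTranspose_mul_self _

/-- The coercion of a real symmetric matrix is Hermitian. [folklore] -/
private theorem conjTranspose_map_ofReal {A : Matrix (Fin r) (Fin r) ℝ} (hA : A.IsHermitian) :
    (A.map ((↑) : ℝ → ℂ))ᴴ = A.map ((↑) : ℝ → ℂ) := by
  rw [← Complex.coe_algebraMap]
  have hf : Function.Semiconj (⇑(algebraMap ℝ ℂ)) star star := fun x => by simp
  rw [← conjTranspose_map _ hf, hA.eq]

/-- Traces of products commute with the coercion `ℝ → ℂ`. [folklore] -/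
private theorem trace_map_ofReal_mul (A B : Matrix (Fin r) (Fin r) ℝ) :
    (A.map ((↑) : ℝ → ℂ) * B.map ((↑) : ℝ → ℂ)).trace = (((A * B).trace : ℝ) : ℂ) := by
  simp [Matrix.trace, Matrix.mul_apply, Complex.ofReal_sum, Complex.ofReal_mul]

/-- The coercion `ℝ → ℂ` commutes with finite sums of matrices. [folklore] -/
private theorem map_ofReal_sum {ι : Type*} [Fintype ι] (E : ι → Matrix (Fin r) (Fin r) ℝ) :
    ∑ a, (E a).map ((↑) : ℝ → ℂ) = (∑ a, E a).map ((↑) : ℝ → ℂ) := by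
  ext i j; simp [Matrix.sum_apply]

/-- Real form of `Tr(AB) ≤ Tr A · Tr B` for psd `A, B`. [folklore] -/
private theorem trace_mul_le_real {A B : Matrix (Fin r) (Fin r) ℝ} (hA : A.PosSemidef)
    (hB : B.PosSemidef) : (A * B).trace ≤ A.trace * B.trace := by
  have h := re_trace_mul_le_mul_trace (posSemidef_map_ofReal hA) (posSemidef_map_ofReal hB)
  have hA' : (A.map ((↑) : ℝ → ℂ)).trace.re = A.trace := by simp [Matrix.trace, Complex.re_sum]
  have hB' : (B.map ((↑) : ℝ → ℂ)).trace.re = B.trace := by simp [Matrix.trace, Complex.re_sum]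
  rwa [trace_map_ofReal_mul, Complex.ofReal_re, hA', hB'] at h

/-- Real form of `Tr(AB) ≥ 0` for psd `A, B`. [folklore] -/
private theorem trace_mul_nonneg_real {A B : Matrix (Fin r) (Fin r) ℝ} (hA : A.PosSemidef)
    (hB : B.PosSemidef) : 0 ≤ (A * B).trace := by
  have h := re_trace_mul_nonneg_of_posSemidef (posSemidef_map_ofReal hA) (posSemidef_map_ofReal hB)
  rwa [trace_map_ofReal_mul, Complex.ofReal_re] at h

/-- For real symmetric `A`: `0 ≤ Tr(A²)` (`= Tr(A Aᵀ) = Σ A_{ij}²`). [folklore] -/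
private theorem trace_mul_self_nonneg_real {A : Matrix (Fin r) (Fin r) ℝ} (hA : A.IsHermitian) :
    0 ≤ (A * A).trace := by
  have h := trace_mul_conjTranspose_self_re_nonneg (A.map ((↑) : ℝ → ℂ))
  rwa [conjTranspose_map_ofReal hA, trace_map_ofReal_mul, Complex.ofReal_re] at h

/-- Real form of `Tr(A²) ≤ (Tr A)²` for psd `A`. [folklore] -/
private theorem trace_mul_self_le_sq_real {A : Matrix (Fin r) (Fin r) ℝ} (hA : A.PosSemidef) :
    (A * A).trace ≤ A.trace ^ 2 := by
  rw [sq]; exact trace_mul_le_real hA hA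

/-- Real form of the Hilbert–Schmidt Cauchy–Schwarz inequality for symmetric matrices:
`Tr(AB)² ≤ Tr(A²) · Tr(B²)`. [folklore] -/
private theorem sq_trace_mul_le_real {A B : Matrix (Fin r) (Fin r) ℝ} (hA : A.IsHermitian)
    (hB : B.IsHermitian) : (A * B).trace ^ 2 ≤ (A * A).trace * (B * B).trace := by
  have h := Literature.MathematicalPhysics.QuantumLattice.norm_trace_mul_sq_le
    (A.map ((↑) : ℝ → ℂ)) (B.map ((↑) : ℝ → ℂ))
  rw [conjTranspose_map_ofReal hA, conjTranspose_map_ofReal hB, trace_map_ofReal_mul,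
    trace_map_ofReal_mul, trace_map_ofReal_mul, Complex.ofReal_re, Complex.ofReal_re,
    Complex.norm_real, Real.norm_eq_abs, sq_abs] at h
  exact h

/-- Real form of the measurement inequality `Tr(QρQσ) ≤ (Σ_a √Tr(E_aρ) √Tr(E_aσ))²`, `Q = Σ_a E_a`,
for real psd `E_a, ρ, σ` (from `FidelityBound.re_trace_le_sq_sum_sqrt`).
[cite: LeeWeiDeWolf2017, Facts 8–9 (p05–p06)] -/
private theorem trace_le_sq_sum_sqrt_real {ι : Type*} [Fintype ι] (E : ι → Matrix (Fin r) (Fin r) ℝ)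
    (hE : ∀ a, (E a).PosSemidef) {ρ σ : Matrix (Fin r) (Fin r) ℝ} (hρ : ρ.PosSemidef)
    (hσ : σ.PosSemidef) :
    ((∑ a, E a) * ρ * ((∑ a, E a) * σ)).trace ≤
      (∑ a, √((E a * ρ).trace) * √((E a * σ).trace)) ^ 2 := by
  have h := re_trace_le_sq_sum_sqrt (fun a => (E a).map ((↑) : ℝ → ℂ))
    (fun a => posSemidef_map_ofReal (hE a)) (posSemidef_map_ofReal hρ) (posSemidef_map_ofReal hσ)
  simp only [trace_map_ofReal_mul, Complex.ofReal_re] at h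
  rw [map_ofReal_sum, ← Complex.coe_algebraMap, ← Matrix.map_mul, ← Matrix.map_mul,
    ← Matrix.map_mul, Complex.coe_algebraMap] at h
  have e : (((∑ a, E a) * ρ * ((∑ a, E a) * σ)).map ((↑) : ℝ → ℂ)).trace.re =
      ((∑ a, E a) * ρ * ((∑ a, E a) * σ)).trace := by simp [Matrix.trace, Complex.re_sum]
  rwa [e] at h

/-- **LWdW Lemma 17 for the real psd-rank, for every factorization** (p09, verbatim for a
size-optimal one: "Let `P` be an `m`-by-`n` matrix where each column is a probability distribution. If
`rank_psd(P) = r`, then there exists a PSD-factorization for `P(i,j) = Tr(E_i F_j)` such that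
`Tr(F_j) = 1` for each `j` and `Σ_{i=1}^m E_i = I`, where `I` is the `r`-dimensional identity."):
every real psd factorization of size `r` of a column-stochastic `P` (with `m ≥ 1` rows) can be
replaced by one of the same size with `Σ_i E_i = I_r` and `Tr F_j = 1` — by the congruence normalisation
`A_i = Rᵀ E_i R` (`exists_posSemidef_sum_eq_one_congr`) and `F_j = R B_j Rᵀ`
(`Tr F_j = Σ_i Tr(E_i F_j) = Σ_i P(i,j) = 1`). [cite: LeeWeiDeWolf2017, Lemma 17 (p09)] -/
theorem LeeWeiDeWolf2017_lemma17_real {P : Fin m → Fin n → ℝ} (hm : 0 < m)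
    (hPr : HasPsdFactorization P r) (hcol : ∀ j, ∑ i, P i j = 1) :
    ∃ (E : Fin m → Matrix (Fin r) (Fin r) ℝ) (F : Fin n → Matrix (Fin r) (Fin r) ℝ),
      (∀ i, (E i).PosSemidef) ∧ (∀ j, (F j).PosSemidef) ∧ ∑ i, E i = 1 ∧ (∀ j, (F j).trace = 1) ∧
        ∀ i j, P i j = (E i * F j).trace := by
  haveI : Nonempty (Fin m) := ⟨⟨0, hm⟩⟩
  obtain ⟨A, B, hA, hB, hPAB⟩ := hPr
  obtain ⟨R, E, hE, hE1, hAE⟩ := exists_posSemidef_sum_eq_one_congr A hA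
  have hRt : Rᴴ = Rᵀ := conjTranspose_eq_transpose_of_trivial R
  refine ⟨E, fun j => R * B j * Rᵀ, hE, fun j => ?_, hE1, fun j => ?_, fun i j => ?_⟩
  · simpa [hRt] using (hB j).mul_mul_conjTranspose_same R
  · have hP : ∀ i, P i j = (E i * (R * B j * Rᵀ)).trace := fun i => by
      rw [hPAB, hAE, show Rᵀ * E i * R * B j = Rᵀ * (E i * R * B j) by simp only [Matrix.mul_assoc],
        trace_mul_comm]
      simp only [Matrix.mul_assoc]
    calc (R * B j * Rᵀ).trace = ((∑ i, E i) * (R * B j * Rᵀ)).trace := by rw [hE1, Matrix.one_mul]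
      _ = ∑ i, P i j := by rw [Finset.sum_mul, trace_sum]; exact Finset.sum_congr rfl fun i _ => (hP i).symm
      _ = 1 := hcol j
  · rw [hPAB, hAE, show Rᵀ * E i * R * B j = Rᵀ * (E i * R * B j) by simp only [Matrix.mul_assoc],
      trace_mul_comm]
    simp only [Matrix.mul_assoc]

/-- **LWdW Theorem 24 for the real psd-rank** (p10, verbatim: "Definition 23. For nonnegative stochastic
matrix `P`, define `B₄(P) = Σ_i max_j P(i,j)`. Theorem 24. `rank_psd(P) ≥ B₄(P)`."; printed proof:
normalise, `Tr ρ_j = 1 ⇒ ρ_j ⪯ I`, `Tr(E_i) ≥ max_j Tr(E_iρ_j) = max_j P(i,j)`, `r = Σ_i Tr(E_i)`).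
Typed for the tree's real factorizations (`rank_psd^ℝ ≥ rank_psd ≥ B₄`) and with `max_j` as an
arbitrary column selection `c(i)`: `Σ_i P(i, c(i)) ≤ r`. [cite: LeeWeiDeWolf2017, Def. 23 and Thm. 24 (p10)] -/
theorem LeeWeiDeWolf2017_thm24_real {P : Fin m → Fin n → ℝ} (hPr : HasPsdFactorization P r)
    (hcol : ∀ j, ∑ i, P i j = 1) (c : Fin m → Fin n) : ∑ i, P i (c i) ≤ r := by
  rcases Nat.eq_zero_or_pos m with hm | hm
  · subst hm
    simp
  obtain ⟨E, F, hE, hF, hE1, hF1, hP⟩ := LeeWeiDeWolf2017_lemma17_real hm hPr hcol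
  calc ∑ i, P i (c i) ≤ ∑ i, (E i).trace := Finset.sum_le_sum fun i _ => by
        rw [hP]
        have := trace_mul_le_real (hE i) (hF (c i))
        rwa [hF1, mul_one] at this
    _ = r := by rw [← trace_sum, hE1, trace_one, Fintype.card_fin]

/-- `B₄` with a genuine maximum: `Σ_i max_j P(i,j) ≤ r` for a real psd factorization of size `r`
(`n ≥ 1`). [cite: LeeWeiDeWolf2017, Thm. 24 (p10)] -/
theorem LeeWeiDeWolf2017_thm24_real_sup {P : Fin m → Fin n → ℝ} (hPr : HasPsdFactorization P r)
    (hcol : ∀ j, ∑ i, P i j = 1) (hn : 0 < n) :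
    ∑ i, Finset.univ.sup' (Finset.univ_nonempty_iff.mpr ⟨⟨0, hn⟩⟩) (P i) ≤ r := by
  have hne : (Finset.univ : Finset (Fin n)).Nonempty := Finset.univ_nonempty_iff.mpr ⟨⟨0, hn⟩⟩
  choose c _ hc using fun i => Finset.exists_mem_eq_sup' hne (P i)
  simp_rw [hc]
  exact LeeWeiDeWolf2017_thm24_real hPr hcol c

/-- **LWdW Theorem 29 for the real psd-rank** (p10, verbatim: "Definition 28. For a nonnegative
stochastic matrix `P`, define `B₅(P) = Σ_i max_{q^{(i)}} (Σ_k q^{(i)}_k P(i,k)) /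
√(Σ_{s,t} q^{(i)}_s q^{(i)}_t F(P_s,P_t)²)`, where `P_s` is the `s`th column of `P`, and for every `i`,
`q^{(i)}` is a probability distribution. Theorem 29. `rank_psd(P) ≥ B₅(P)`."; printed proof: normalise,
`σ_i = Σ_k q^{(i)}_k ρ_k`, `Tr²(E_iσ_i) ≤ Tr(E_i²)Tr(σ_i²) ≤ Tr(E_i)² Σ_{s,t} q_s q_t F(P_s,P_t)²`,
`Σ_i Tr(E_i) = r`). Typed for the tree's real factorizations and with the maxima as arbitrary
probability vectors `q i`: `Σ_i (Σ_k q_{ik} P(i,k)) / √(Σ_{s,t} q_{is} q_{it} F(P_s,P_t)²) ≤ r`.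
[cite: LeeWeiDeWolf2017, Def. 28 and Thm. 29 (p10)] -/
theorem LeeWeiDeWolf2017_thm29_real {P : Fin m → Fin n → ℝ} (hPr : HasPsdFactorization P r)
    (hcol : ∀ j, ∑ i, P i j = 1) (q : Fin m → Fin n → ℝ) (hq : ∀ i k, 0 ≤ q i k)
    (hq1 : ∀ i, ∑ k, q i k = 1) :
    ∑ i, (∑ k, q i k * P i k) /
      √(∑ s, ∑ t, q i s * q i t * classicalFidelity (fun k => P k s) (fun k => P k t) ^ 2) ≤ r := by
  rcases Nat.eq_zero_or_pos m with hm | hm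
  · subst hm
    simp
  obtain ⟨E, F, hE, hF, hE1, hF1, hP⟩ := LeeWeiDeWolf2017_lemma17_real hm hPr hcol
  calc ∑ i, (∑ k, q i k * P i k) /
        √(∑ s, ∑ t, q i s * q i t * classicalFidelity (fun k => P k s) (fun k => P k t) ^ 2)
      ≤ ∑ i, (E i).trace := Finset.sum_le_sum fun i _ => ?_
    _ = r := by rw [← trace_sum, hE1, trace_one, Fintype.card_fin]
  -- one row `i`: `σ = Σ_k q_k F_k`, `N = Tr(E_i σ)`, `D = Σ q_s q_t F(P_s,P_t)² ≥ Tr σ²`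
  set σ : Matrix (Fin r) (Fin r) ℝ := ∑ k, q i k • F k with hσdef
  set D := ∑ s, ∑ t, q i s * q i t * classicalFidelity (fun k => P k s) (fun k => P k t) ^ 2 with hDdef
  have hσ : σ.PosSemidef := posSemidef_sum _ fun k _ => (hF k).smul (hq i k)
  have hE0 : 0 ≤ (E i).trace := (hE i).trace_nonneg
  have hN : ∑ k, q i k * P i k = (E i * σ).trace := by
    rw [hσdef, Finset.mul_sum, trace_sum]
    exact Finset.sum_congr rfl fun k _ => by rw [Matrix.mul_smul, trace_smul, smul_eq_mul, hP]
  have hN0 : 0 ≤ (E i * σ).trace := trace_mul_nonneg_real (hE i) hσ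
  -- `Tr σ² ≤ D` (the `B₃` computation with `Σ_k E_k = I`)
  have hσσ : (σ * σ).trace ≤ D := by
    have e : (σ * σ).trace = ∑ s, ∑ t, q i s * q i t * (F s * F t).trace := by
      rw [hσdef, Finset.sum_mul, trace_sum]
      refine Finset.sum_congr rfl fun s _ => ?_
      rw [Finset.mul_sum, trace_sum]
      refine Finset.sum_congr rfl fun t _ => ?_
      rw [Matrix.smul_mul, Matrix.mul_smul, smul_smul, trace_smul, smul_eq_mul]
    rw [e, hDdef]
    refine Finset.sum_le_sum fun s _ => Finset.sum_le_sum fun t _ =>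
      mul_le_mul_of_nonneg_left ?_ (mul_nonneg (hq i s) (hq i t))
    have key := trace_le_sq_sum_sqrt_real E hE (hF s) (hF t)
    rw [hE1, Matrix.one_mul, Matrix.one_mul] at key
    simp_rw [← hP] at key
    exact key
  -- Cauchy–Schwarz and `Tr E² ≤ (Tr E)²`
  have hcs : (E i * σ).trace ^ 2 ≤ ((E i).trace * √D) ^ 2 :=
    calc (E i * σ).trace ^ 2 ≤ (E i * E i).trace * (σ * σ).trace := sq_trace_mul_le_real (hE i).1 hσ.1
      _ ≤ (E i).trace ^ 2 * D := mul_le_mul (trace_mul_self_le_sq_real (hE i)) hσσ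
          (trace_mul_self_nonneg_real hσ.1) (sq_nonneg _)
      _ = ((E i).trace * √D) ^ 2 := by
          rw [mul_pow, Real.sq_sqrt ((trace_mul_self_nonneg_real hσ.1).trans hσσ)]
  have hle : (E i * σ).trace ≤ (E i).trace * √D :=
    (pow_le_pow_iff_left₀ hN0 (mul_nonneg hE0 (Real.sqrt_nonneg _)) two_ne_zero).mp hcs
  rw [hN]
  rcases (Real.sqrt_nonneg D).eq_or_lt with hD | hD
  · rw [← hD, div_zero]; exact hE0
  · rwa [div_le_iff₀ hD]

end RealBounds

end Literature.Combinatorics.Optimization
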